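import Summits.BirchSwinnertonDyer.BirchSwinnertonDyer.Theorems.QuadraticBranchSignedControlEtaLayerPackages
import Summits.BirchSwinnertonDyer.Rank1Residual.X11b.AnticyclotomicLocalTowerTorsion
import Summits.BirchSwinnertonDyer.Rank1Residual.X11b.CoinvariantsLocal
import Summits.BirchSwinnertonDyer.Rank1Residual.Additive.ZpTowerSeam
import Literature.NumberTheory.EllipticCurves.LocalTorsionInvariants
import Literature.NumberTheory.EllipticCurves.SelmerTorsionRestriction
import HarnessLib

/-!
# The local torsion DICTIONARY along the `ℤ_p`-tower: `#E(K_{m,w})[n] = #E[n]^{D_v ∩ Γ_m}` at EVERY place `w ∣ v` of the layer `K_m`,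
# and `E[n]^{D_v ∩ Γ_m} = E[n]^{ker(κ|D_v)}` for `m ≫ 0`
# (crux ♭T≤ stmt-BirchSwinnertonDyer-23042, line `sigmacongruence`, stub R1 `stub_relaxedImageCount`, brick (e) LOCAL SIZE)

Width prover `bsd-wall-utd-p1-w2` g2 under lead `bsd-wall-utd-p1` g18 (`--supports stmt-BirchSwinnertonDyer-23042`, helper).
THEOREMS ONLY (no definition, no named fact, no `sorry`). BSD is not proved by any of this.

Setting: `K` a number field, `W/K` elliptic, `p` prime, `κ : Γ_K ↠ ℤ_p` with layers `K_m = κ.layer m` (`Γ_m = κ⁻¹(p^m ℤ_p) = galRange K_m`),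
`v` a finite place of `K` with decomposition group `D_v = decomp v` (chosen embedding `K̄ → K̄_v`), `n : ℤ`, `n ≠ 0`.
The lead's relaxed count road (memo `Lines/sigmacongruence-relaxed-count-road.md` §2 (e)) reads the local factor of the Poitou–Tate count
over `K_m` at a place `w ∣ v` as `#E(K_{m,w})[p^k]` and needs it in `Γ_K`-currency:

* §1 `natCard_ker_zsmul_adicCompletion_layer_eq` — for EVERY `m` and EVERY place `w` of `K_m` over `v`:
  `#{P ∈ (W⁄K_m)(K_{m,w}) : n • P = 0} = #{P ∈ E[n] : g • P = P for all g ∈ D_v ⊓ Γ_m}`.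
  Proof: `H⁰(K_{m,w}, E[n]) = E(K_{m,w})[n]` (tree `invariantsTorsionEquivKerZSMul`, Milne I §3) for the `K_m`-field `K_{m,w}`; the local
  package `(ι, ι₂, ι_w)` at `v` from the CHOSEN `K_m`-embedding `ι_w : K̄_m → K̄_{m,w}` (cell `bsd-potss`,
  `EtaLayer.exists_package_adicCompletion_of_embedding`) identifies `resGal K_m (D^{K_m}_w)` with `range (res_ι) ∩ Γ_m` (transport
  `ι₂(·)ι₂⁻¹` and its inverse, `resGal_resGalOfEmb_transportAut` / `resGalOfEmb_transportAut_symm`); `ι = ι_v ∘ τ` for some `τ ∈ Γ_K`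
  (`exists_algHom_eq_comp`), so `range (res_ι) = τ⁻¹ D_v τ`; and `P ↦ (E[n] ≃ E_{K_m}[n]) (τ⁻¹ • P)` (`torsionBaseChangeEquiv_smul`) is a
  bijection from the `D_v ⊓ Γ_m`-fixed points onto the `D^{K_m}_w`-invariants.
* §2 `exists_forall_fixedBy_decomp_inf_layerSubgroup_iff` — there is `m₀ = m₀(n)` such that for all `m ≥ m₀` and all `P ∈ E[n]`:
  `P` is fixed by `D_v ⊓ Γ_m` iff it is fixed by `ker(κ|_{D_v})` (`kerD κ v`): compactness of `D_v` on the finite `E[n]`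
  (X11b `exists_layerSubgroup_inf_le_stabilizer`); and the count `natCard_fixedBy_decomp_inf_layerSubgroup_eq_of_le`.
* §3 `exists_forall_natCard_ker_zsmul_adicCompletion_layer_eq` — hence for `m ≥ m₀(n)` and every `w ∣ v`:
  `#E(K_{m,w})[n] = #E[n]^{ker(κ|D_v)}`; §4 the same in the `E[p^∞]`-currency of the line's stubs
  (`{a : E[p^∞] // kerD-fixed ∧ p^k • a = 0}`, as in R3 `stub_localTorsionCountAtTame`).

References: [MilneADT2006] I §3 (Lemma 3.3: `H⁰(K, A_n) = A(K)_n`); [SilvermanAEC2009] VIII.§1; [GreenbergLNM1716] §2 (pp. 62–63: the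
decomposition groups of the primes of `M` over a prime of `F`), §3 Lemma 3.3; [SerreGaloisCohomology1997] II.§1.1; [NeukirchANT1999] II.§8;
[Washington1997] §13.1.
-/

-- `…BirchSwinnertonDyer.BirchSwinnertonDyer…` is the problem's mandated namespace (D-0017 nested layout)
set_option linter.dupNamespace false
set_option autoImplicit false

noncomputable section
open scoped Classical
open Field NumberField IsDedekindDomain Function WeierstrassCurve
open Literature.NumberTheory.EllipticCurves Literature.NumberTheory.EllipticCurves.GreenbergSelmer
open Literature.NumberTheory.GaloisRepresentations

namespace Summit.BirchSwinnertonDyer.BirchSwinnertonDyer.Theorems.UniversalToricDescentLayerLocalTorsionDictionary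

open Summit.BirchSwinnertonDyer.Rank1Residual.Additive Summit.BirchSwinnertonDyer.Rank1Residual.Additive.ZpTower
  Summit.BirchSwinnertonDyer.Rank1Residual.Additive.LocalTransport
  Summit.BirchSwinnertonDyer.Rank1Residual.X11b.AcSelmer Summit.BirchSwinnertonDyer.Rank1Residual.X11b.Coinv
  Summit.BirchSwinnertonDyer.BirchSwinnertonDyer.Theorems.EtaLayer

variable {K : Type} [Field K] [NumberField K] (W : WeierstrassCurve K) [W.IsElliptic] (p : ℕ) [Fact p.Prime]
  (κ : ZpExtension K p) (v : HeightOneSpectrum (𝓞 K))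

/-! ## §1 The dictionary at every layer and every place above `v` -/

/-- **`#E(K_{m,w})[n] = #E[n]^{D_v ⊓ Γ_m}` for every layer `m` and EVERY place `w ∣ v` of `K_m`** (`n ≠ 0`): the `K_{m,w}`-rational
`n`-torsion of `W⁄K_m` is in bijection with the points of `E[n] = E(K̄)[n]` fixed by `decomp v ⊓ κ.layerSubgroup m` — `H⁰(K_{m,w}, E[n])`
is `E(K_{m,w})[n]` (Milne I §3), the decomposition group of `K_m` at `w` restricts onto a `Γ_K`-conjugate `τ⁻¹(D_v ∩ Γ_m)τ` (local package at
`v` + `ι = ι_v ∘ τ`), and `P ↦ τ⁻¹ • P` matches the fixed points. [cite: MilneADT2006, I §3 Lemma 3.3] [cite: GreenbergLNM1716, §2 (pp. 62–63)]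
[cite: SerreGaloisCohomology1997, II.§1.1] [cite: NeukirchANT1999, Ch. II §8] -/
theorem natCard_ker_zsmul_adicCompletion_layer_eq (m : ℕ) {n : ℤ} (hn : n ≠ 0) (w : HeightOneSpectrum (𝓞 (κ.layer m)))
    [w.asIdeal.LiesOver v.asIdeal] :
    Nat.card (zsmulAddGroupHom n :
        ((W.baseChange (κ.layer m)).baseChange (w.adicCompletion (κ.layer m))).toAffine.Point →+ _).ker =
      Nat.card {P : W.geomTorsion n // ∀ g ∈ decomp (K := K) v ⊓ κ.layerSubgroup m, g • P = P} := by
  -- notation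
  let L : Type := κ.layer m
  let F : Type := w.adicCompletion (κ.layer m)
  haveI : CharZero F := charZero_of_injective_algebraMap (algebraMap L F).injective
  let ιv : AlgebraicClosure K →ₐ[K] AlgebraicClosure (v.adicCompletion K) := closureEmb (K := K) (v.adicCompletion K)
  let ιw : AlgebraicClosure L →ₐ[L] AlgebraicClosure F := closureEmb (K := L) F
  -- the local package at `v` for the chosen `L`-embedding `ιw`
  obtain ⟨ι, ι₂, hcompat, hf, hfix⟩ :=
    exists_package_adicCompletion_of_embedding (κ.layer m) v (RingEquiv.refl _) (fun _ ↦ rfl) w ιw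
  -- `ι = ιv ∘ τ`
  obtain ⟨τ, rfl⟩ := exists_algHom_eq_comp ιv ι
  let t : absoluteGaloisGroup K := τ
  have hseam : galRange (K := K) L = κ.layerSubgroup m := galRange_layer_eq_layerSubgroup κ m
  -- (A) `resGal L (res_{ιw} g) ∈ t⁻¹ D_v t ∩ Γ_m` for every `g ∈ Γ_F`
  have hA : ∀ g : absoluteGaloisGroup F,
      t * resGal (K := K) L (resGalOfEmb (K := L) ιw g) * t⁻¹ ∈ decomp (K := K) v ⊓ κ.layerSubgroup m := by
    intro g
    refine Subgroup.mem_inf.mpr ⟨?_, ?_⟩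
    · -- into `D_v`: the inverse transport `hK = ι₂⁻¹ g ι₂ ∈ Γ_{K_v}` restricts (along `ιv ∘ τ`) to `resGal L (res_{ιw} g)`
      let hK : absoluteGaloisGroup (v.adicCompletion K) := transportAut ι₂.symm g
        (fix_symm ι₂ ((adicCompletionMap (K := K) L v w).comp (RingEquiv.refl (v.adicCompletion K)).symm.toRingHom) hf g)
      have key : resGalOfEmb (ιv.comp (τ : AlgebraicClosure K →ₐ[K] AlgebraicClosure K)) hK =
          resGal (K := K) L (resGalOfEmb (K := L) ιw g) :=
        resGalOfEmb_transportAut_symm L _ ι₂ ιw hcompat g _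
      rw [resGalOfEmb_comp_apply] at key
      -- key : t⁻¹ * res_{ιv} hK * t = resGal L (res_{ιw} g)
      rw [← key]
      have hgrp : t * (t⁻¹ * resGalOfEmb ιv hK * t) * t⁻¹ = resGalOfEmb ιv hK := by group
      rw [hgrp]
      exact (mem_decomp_iff v _).mpr ⟨hK, rfl⟩
    · -- into `Γ_m`: `resGal L σ ∈ galRange L = Γ_m`, a normal subgroup
      have hσ : resGal (K := K) L (resGalOfEmb (K := L) ιw g) ∈ κ.layerSubgroup m := by
        rw [← hseam]; exact ⟨_, rfl⟩
      exact (inferInstance : (κ.layerSubgroup m).Normal).conj_mem _ hσ t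
  -- (B) conversely every `d ∈ D_v ∩ Γ_m` is `t σ t⁻¹` with `σ = resGal L (res_{ιw} g)` for some `g ∈ Γ_F`
  have hB : ∀ d ∈ decomp (K := K) v ⊓ κ.layerSubgroup m, ∃ g : absoluteGaloisGroup F,
      d = t * resGal (K := K) L (resGalOfEmb (K := L) ιw g) * t⁻¹ := by
    intro d hd
    obtain ⟨hdD, hdΓ⟩ := Subgroup.mem_inf.mp hd
    -- `t⁻¹ d t ∈ Γ_m = galRange L`
    have hd' : t⁻¹ * d * t ∈ galRange (K := K) L := by
      rw [hseam]
      have h := Subgroup.Normal.conj_mem (inferInstance : (κ.layerSubgroup m).Normal) d hdΓ t⁻¹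
      rwa [inv_inv] at h
    obtain ⟨σ, hσ⟩ := hd'
    -- `t⁻¹ d t ∈ range (res_ι)`: `ι = ιv ∘ τ`, `d = res_{ιv} h`
    obtain ⟨h, hh⟩ := (mem_decomp_iff v d).mp hdD
    have hres : resGalOfEmb (ιv.comp (τ : AlgebraicClosure K →ₐ[K] AlgebraicClosure K)) h = t⁻¹ * d * t := by
      rw [resGalOfEmb_comp_apply]
      change t⁻¹ * absGaloisRestrict K (v.adicCompletion K) h * t = _
      rw [hh]
    have hmem : resGalOfEmb (ιv.comp (τ : AlgebraicClosure K →ₐ[K] AlgebraicClosure K)) h ∈ galRange (K := K) L := ⟨σ, hσ.trans hres.symm⟩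
    -- transport `h ↦ ι₂ h ι₂⁻¹ ∈ Γ_F`
    refine ⟨transportAut ι₂ h (hfix h hmem), ?_⟩
    have key := resGal_resGalOfEmb_transportAut L (ιv.comp (τ : AlgebraicClosure K →ₐ[K] AlgebraicClosure K)) ι₂ ιw hcompat h (hfix h hmem)
    rw [key, hres]
    group
  -- the coefficient isomorphism and the bijection
  let e : W.geomTorsion n ≃+ (W.baseChange L).geomTorsion n := torsionBaseChangeEquiv L W n
  have he : ∀ (σ : absoluteGaloisGroup L) (P : W.geomTorsion n), e (resGal (K := K) L σ • P) = σ • e P := fun σ P ↦ by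
    have h := torsionBaseChangeEquiv_smul L W n σ P
    rwa [Subgroup.smul_def, coe_resGalToRange] at h
  rw [← Nat.card_congr ((W.baseChange L).invariantsTorsionEquivKerZSMul F hn).toEquiv]
  symm
  refine Nat.card_congr (Equiv.ofBijective
    (fun P : {P : W.geomTorsion n // ∀ g ∈ decomp (K := K) v ⊓ κ.layerSubgroup m, g • P = P} ↦
      (⟨e (t⁻¹ • (P : W.geomTorsion n)), ?_⟩ :
        (GaloisRep.restrictField F ((W.baseChange L).torsionGaloisModule n)).invariants)) ⟨?_, ?_⟩)
  · -- invariance under `Γ_F`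
    rw [ContinuousRep.mem_invariants]
    intro g
    rw [restrictField_torsionGaloisModule_apply]
    change resGalOfEmb (K := L) ιw g • e (t⁻¹ • (P : W.geomTorsion n)) = e (t⁻¹ • (P : W.geomTorsion n))
    rw [← he]
    congr 1
    have hfixP := P.2 _ (hA g)
    -- `(t σ t⁻¹) • P = P ⟹ σ • t⁻¹ • P = t⁻¹ • P`
    conv_rhs => rw [← hfixP]
    rw [← mul_smul, ← mul_smul]
    congr 1
    group
  · -- injective
    intro a b hab
    dsimp only at hab
    have h1 : e (t⁻¹ • (a : W.geomTorsion n)) = e (t⁻¹ • (b : W.geomTorsion n)) := Subtype.mk.inj hab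
    exact Subtype.ext (smul_left_cancel_iff t⁻¹ |>.mp (e.injective h1))
  · -- surjective
    rintro ⟨Q, hQ⟩
    rw [ContinuousRep.mem_invariants] at hQ
    refine ⟨⟨t • e.symm Q, fun d hd ↦ ?_⟩, Subtype.ext ?_⟩
    · obtain ⟨g, rfl⟩ := hB d hd
      have hg : resGalOfEmb (K := L) ιw g • Q = Q := by
        have h := hQ g
        rwa [restrictField_torsionGaloisModule_apply] at h
      have hg' : resGal (K := K) L (resGalOfEmb (K := L) ιw g) • e.symm Q = e.symm Q := by
        apply e.injective
        rw [he, AddEquiv.apply_symm_apply, hg]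
      rw [mul_smul, mul_smul, inv_smul_smul, hg']
    · change e (t⁻¹ • t • e.symm Q) = Q
      rw [inv_smul_smul, AddEquiv.apply_symm_apply]

/-- The `ℕ`-level form of §1: **`#ker (· • N) on E(K_{m,w}) = #E[N]^{D_v ⊓ Γ_m}`** for `N : ℕ`, `N ≠ 0` (the currency of the tree's local
counts `natCard_kummerSelmerStructure_inr…`, `natCard_invariants_torsion_restrictField`). [cite: MilneADT2006, I §3 Lemma 3.3] -/
theorem natCard_ker_nsmul_adicCompletion_layer_eq (m : ℕ) {N : ℕ} (hN : N ≠ 0) (w : HeightOneSpectrum (𝓞 (κ.layer m)))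
    [w.asIdeal.LiesOver v.asIdeal] :
    Nat.card (nsmulAddMonoidHom N :
        ((W.baseChange (κ.layer m)).baseChange (w.adicCompletion (κ.layer m))).toAffine.Point →+ _).ker =
      Nat.card {P : W.geomTorsion (N : ℤ) // ∀ g ∈ decomp (K := K) v ⊓ κ.layerSubgroup m, g • P = P} := by
  have hker : (nsmulAddMonoidHom N :
      ((W.baseChange (κ.layer m)).baseChange (w.adicCompletion (κ.layer m))).toAffine.Point →+ _).ker =
      (zsmulAddGroupHom (N : ℤ) :
        ((W.baseChange (κ.layer m)).baseChange (w.adicCompletion (κ.layer m))).toAffine.Point →+ _).ker := by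
    ext P
    simp only [AddMonoidHom.mem_ker, zsmulAddGroupHom_apply, nsmulAddMonoidHom_apply, natCast_zsmul]
  rw [hker]
  exact natCard_ker_zsmul_adicCompletion_layer_eq W p κ v m (Int.natCast_ne_zero.mpr hN) w

/-! ## §2 Deep layers: `E[n]^{D_v ⊓ Γ_m} = E[n]^{ker(κ|D_v)}` for `m ≥ m₀(n)` -/

/-- **For `m ≫ 0` a point of `E[n]` (`n ≠ 0`) is fixed by `D_v ⊓ Γ_m` iff it is fixed by `ker(κ|_{D_v})`**: `kerD ≤ D_v ⊓ Γ_m` always; conversely the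
finitely many `kerD`-fixed points of `E[n]` have an open common stabiliser, which contains `D_v ∩ Γ_{m₀}` for some `m₀` by compactness of `D_v`
(X11b `exists_layerSubgroup_inf_le_stabilizer`). [cite: Washington1997, §13.1] [cite: GreenbergLNM1716, §3 Lemma 3.1 (p. 86)] -/
theorem exists_forall_fixedBy_decomp_inf_layerSubgroup_iff {n : ℤ} (hn : n ≠ 0) :
    ∃ m₀ : ℕ, ∀ m : ℕ, m₀ ≤ m → ∀ P : W.geomTorsion n,
      (∀ g ∈ decomp (K := K) v ⊓ κ.layerSubgroup m, g • P = P) ↔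
        ∀ g : kerD κ v, ((g : decomp (K := K) v) : absoluteGaloisGroup K) • P = P := by
  haveI : Finite (W.geomTorsion n) := W.finite_torsionPoints_holds (AlgebraicClosure K) hn
  -- the finite set of `kerD`-fixed points and its stabilising layer
  set A : Set (W.geomTorsion n) := {P | ∀ g : kerD κ v, ((g : decomp (K := K) v) : absoluteGaloisGroup K) • P = P} with hA
  have hAfin : A.Finite := Set.toFinite A
  have hAN : ∀ P ∈ A, ∀ g ∈ decomp (K := K) v ⊓ κ.kerSubgroup, g • P = P := by
    intro P hP g hg
    obtain ⟨hgD, hgk⟩ := Subgroup.mem_inf.mp hg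
    exact hP ⟨⟨g, hgD⟩, (mem_kerD_iff κ v _).mpr hgk⟩
  have hcont : ∀ P : W.geomTorsion n, Continuous fun g : absoluteGaloisGroup K ↦ g • P := fun P ↦
    continuous_of_injective_comp (G := absoluteGaloisGroup K) Subtype.val_injective (continuous_smul_geomPoints W (P : geomPoints W))
  obtain ⟨m₀, hm₀⟩ := exists_layerSubgroup_inf_le_stabilizer κ (decomp v) (isClosed_decomp v) hcont hAfin hAN
  refine ⟨m₀, fun m hm P ↦ ⟨fun hP g ↦ hP _ (Subgroup.mem_inf.mpr ⟨(g : decomp (K := K) v).2,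
    κ.kerSubgroup_le_layerSubgroup m ((mem_kerD_iff κ v _).mp g.2)⟩), fun hP g hg ↦ ?_⟩⟩
  obtain ⟨hgD, hgm⟩ := Subgroup.mem_inf.mp hg
  exact hm₀ g (Subgroup.mem_inf.mpr ⟨hgD, κ.layerSubgroup_antitone hm hgm⟩) P hP

/-- Hence, for `m ≥ m₀(n)`: `#E[n]^{D_v ⊓ Γ_m} = #E[n]^{ker(κ|D_v)}`. [cite: Washington1997, §13.1] -/
theorem exists_forall_natCard_fixedBy_decomp_inf_layerSubgroup_eq {n : ℤ} (hn : n ≠ 0) :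
    ∃ m₀ : ℕ, ∀ m : ℕ, m₀ ≤ m →
      Nat.card {P : W.geomTorsion n // ∀ g ∈ decomp (K := K) v ⊓ κ.layerSubgroup m, g • P = P} =
        Nat.card {P : W.geomTorsion n // ∀ g : kerD κ v, ((g : decomp (K := K) v) : absoluteGaloisGroup K) • P = P} := by
  obtain ⟨m₀, hm₀⟩ := exists_forall_fixedBy_decomp_inf_layerSubgroup_iff W p κ v hn
  refine ⟨m₀, fun m hm ↦ Nat.card_congr (Equiv.subtypeEquivRight fun P ↦ hm₀ m hm P)⟩

/-! ## §3 The dictionary at deep layers: `#E(K_{m,w})[n] = #E[n]^{ker(κ|D_v)}` -/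

/-- **`#E(K_{m,w})[n] = #E[n]^{ker(κ|_{D_v})}` for `m ≥ m₀(n)` and EVERY place `w ∣ v` of `K_m`** (`n ≠ 0`) — §1 + §2. This is the first half
of step (e) LOCAL SIZE of the lead's relaxed count road (`#E′(L_w)[3^k] = #M^{Γ_n ∩ D_w} = #M^{kerD}`). [cite: MilneADT2006, I §3 Lemma 3.3]
[cite: GreenbergLNM1716, §2 (pp. 62–63), §3 Lemma 3.3] [cite: Washington1997, §13.1] -/
theorem exists_forall_natCard_ker_zsmul_adicCompletion_layer_eq {n : ℤ} (hn : n ≠ 0) :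
    ∃ m₀ : ℕ, ∀ m : ℕ, m₀ ≤ m → ∀ (w : HeightOneSpectrum (𝓞 (κ.layer m))), w.asIdeal.LiesOver v.asIdeal →
      Nat.card (zsmulAddGroupHom n :
          ((W.baseChange (κ.layer m)).baseChange (w.adicCompletion (κ.layer m))).toAffine.Point →+ _).ker =
        Nat.card {P : W.geomTorsion n // ∀ g : kerD κ v, ((g : decomp (K := K) v) : absoluteGaloisGroup K) • P = P} := by
  obtain ⟨m₀, hm₀⟩ := exists_forall_natCard_fixedBy_decomp_inf_layerSubgroup_eq W p κ v hn
  refine ⟨m₀, fun m hm w hw ↦ ?_⟩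
  haveI := hw
  rw [natCard_ker_zsmul_adicCompletion_layer_eq W p κ v m hn w, hm₀ m hm]

/-! ## §4 The same in the `E[p^∞]`-currency of the line's stubs -/

omit [NumberField K] [W.IsElliptic] [Fact p.Prime] in
/-- `E[p^k]` inside `E[p^∞]`: the `p^k`-torsion points of `E[p^∞] = E(K̄)[p^∞]` are in `Γ_K`-equivariant bijection with `E[p^k]`, so the
`H`-fixed `p^k`-torsion of `E[p^∞]` is counted by the `H`-fixed points of `E[p^k]`, for any set of group elements `H`. [cite: SilvermanAEC2009, III.§7] -/
theorem natCard_fixed_pow_torsion_geomPrimaryTorsion_eq (S : Set (absoluteGaloisGroup K)) (k : ℕ) :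
    Nat.card {a : W.geomPrimaryTorsion p // (∀ g ∈ S, g • a = a) ∧ p ^ k • a = 0} =
      Nat.card {P : W.geomTorsion ((p ^ k : ℕ) : ℤ) // ∀ g ∈ S, g • P = P} := by
  refine Nat.card_congr (Equiv.ofBijective
    (fun a : {a : W.geomPrimaryTorsion p // (∀ g ∈ S, g • a = a) ∧ p ^ k • a = 0} ↦
      (⟨⟨((a : W.geomPrimaryTorsion p) : geomPoints W), ?_⟩, fun g hg ↦ ?_⟩ :
        {P : W.geomTorsion ((p ^ k : ℕ) : ℤ) // ∀ g ∈ S, g • P = P})) ⟨?_, ?_⟩)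
  · rw [mem_geomTorsion_iff, natCast_zsmul, ← AddSubgroupClass.coe_nsmul, a.2.2, ZeroMemClass.coe_zero]
  · apply Subtype.ext
    change g • ((a : W.geomPrimaryTorsion p) : geomPoints W) = ((a : W.geomPrimaryTorsion p) : geomPoints W)
    rw [← primaryComponent.coe_smul, a.2.1 g hg]
  · intro a b hab
    dsimp only at hab
    exact Subtype.ext (Subtype.ext (congrArg (fun P : W.geomTorsion ((p ^ k : ℕ) : ℤ) ↦ (P : geomPoints W)) (Subtype.mk.inj hab)))
  · rintro ⟨P, hP⟩
    have hPk : ((p ^ k : ℕ) : ℤ) • (P : geomPoints W) = 0 := (mem_geomTorsion_iff W _ _).mp P.2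
    have hmem : (P : geomPoints W) ∈ W.geomPrimaryTorsion p :=
      (AddCommGroup.mem_primaryComponent).mpr ⟨k, by rwa [natCast_zsmul] at hPk⟩
    refine ⟨⟨⟨(P : geomPoints W), hmem⟩, fun g hg ↦ ?_, ?_⟩, ?_⟩
    · apply Subtype.ext
      rw [primaryComponent.coe_smul]
      change g • (P : geomPoints W) = P
      rw [← AddSubgroup.torsionBy.coe_smul, hP g hg]
    · apply Subtype.ext
      rw [AddSubgroupClass.coe_nsmul, ZeroMemClass.coe_zero]
      change p ^ k • (P : geomPoints W) = 0
      rwa [natCast_zsmul] at hPk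
    · rfl

/-- **(e) in the stubs' currency**: there is `m₀ = m₀(k)` such that for all `m ≥ m₀` and EVERY place `w ∣ v` of `K_m`,
`#E(K_{m,w})[p^k] = #{a ∈ E[p^∞] : ker(κ|D_v)-fixed, p^k a = 0}` (the right-hand side of R3 `stub_localTorsionCountAtTame`, which bounds
`#H¹(kerD κ v, E[p^∞])[p^k]` from above). [cite: MilneADT2006, I §3 Lemma 3.3] [cite: GreenbergVatsal2000, §2 Prop. (2.4) and proof (arXiv p. 22)]
[cite: Washington1997, §13.1] -/
theorem exists_forall_natCard_ker_nsmul_adicCompletion_layer_eq_kerD (k : ℕ) :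
    ∃ m₀ : ℕ, ∀ m : ℕ, m₀ ≤ m → ∀ (w : HeightOneSpectrum (𝓞 (κ.layer m))), w.asIdeal.LiesOver v.asIdeal →
      Nat.card (nsmulAddMonoidHom (p ^ k) :
          ((W.baseChange (κ.layer m)).baseChange (w.adicCompletion (κ.layer m))).toAffine.Point →+ _).ker =
        Nat.card {a : W.geomPrimaryTorsion p //
          (∀ g : kerD κ v, ((g : decomp (K := K) v) : absoluteGaloisGroup K) • a = a) ∧ p ^ k • a = 0} := by
  have hp : p.Prime := Fact.out
  have hn : ((p ^ k : ℕ) : ℤ) ≠ 0 := Int.natCast_ne_zero.mpr (pow_ne_zero k hp.ne_zero)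
  obtain ⟨m₀, hm₀⟩ := exists_forall_natCard_ker_zsmul_adicCompletion_layer_eq W p κ v hn
  refine ⟨m₀, fun m hm w hw ↦ ?_⟩
  haveI := hw
  -- `ℕ`-kernel = `ℤ`-kernel
  have hker : (nsmulAddMonoidHom (p ^ k) :
      ((W.baseChange (κ.layer m)).baseChange (w.adicCompletion (κ.layer m))).toAffine.Point →+ _).ker =
      (zsmulAddGroupHom ((p ^ k : ℕ) : ℤ) :
        ((W.baseChange (κ.layer m)).baseChange (w.adicCompletion (κ.layer m))).toAffine.Point →+ _).ker := by
    ext P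
    simp only [AddMonoidHom.mem_ker, zsmulAddGroupHom_apply, nsmulAddMonoidHom_apply, natCast_zsmul]
  rw [hker, hm₀ m hm w hw]
  -- `kerD`-fixed, set form
  have hS : Nat.card {a : W.geomPrimaryTorsion p //
      (∀ g : kerD κ v, ((g : decomp (K := K) v) : absoluteGaloisGroup K) • a = a) ∧ p ^ k • a = 0} =
      Nat.card {a : W.geomPrimaryTorsion p //
        (∀ g ∈ ((kerD κ v).map (decomp (K := K) v).subtype : Set (absoluteGaloisGroup K)), g • a = a) ∧ p ^ k • a = 0} := by
    refine Nat.card_congr (Equiv.subtypeEquivRight fun a ↦ ?_)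
    refine and_congr_left fun _ ↦ ⟨fun h g hg ↦ ?_, fun h g ↦ h _ ⟨(g : decomp (K := K) v), g.2, rfl⟩⟩
    obtain ⟨d, hd, rfl⟩ := hg
    exact h ⟨d, hd⟩
  have hT : Nat.card {P : W.geomTorsion ((p ^ k : ℕ) : ℤ) //
      ∀ g : kerD κ v, ((g : decomp (K := K) v) : absoluteGaloisGroup K) • P = P} =
      Nat.card {P : W.geomTorsion ((p ^ k : ℕ) : ℤ) //
        ∀ g ∈ ((kerD κ v).map (decomp (K := K) v).subtype : Set (absoluteGaloisGroup K)), g • P = P} := by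
    refine Nat.card_congr (Equiv.subtypeEquivRight fun P ↦ ⟨fun h g hg ↦ ?_, fun h g ↦ h _ ⟨(g : decomp (K := K) v), g.2, rfl⟩⟩)
    obtain ⟨d, hd, rfl⟩ := hg
    exact h ⟨d, hd⟩
  rw [hS, hT, natCard_fixed_pow_torsion_geomPrimaryTorsion_eq]

end Summit.BirchSwinnertonDyer.BirchSwinnertonDyer.Theorems.UniversalToricDescentLayerLocalTorsionDictionary

end
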